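import Summits.Ventures.HSemireg.Pad4TowerLemmaT

/-!
# Venture HSemireg — PAD-4 on (F1ℝ): LEMMA A∪2I′ (§17′) in its CLEAN SUFFICIENT FORM as a finite structure — the census
# species, the served set `W`, the demanded entries, and the entry-wise kill predicate; the two own-ray forms are instances;
# LEMMA T through it (one clean side kills); and LEMMA X-PHASE (§22, (F1ℝ) slice = LEMMA X) as a kill predicate

HONEST FRAMING. Lean index of the computation cell `pub-hsemireg` (S4-PUSH, H2 door PAD-4), typed by the Ventures-side
typer `hodge-lit-semireg-typer-2` (director-hodge g7 ROW SUPPLY, REQUESTS l.11011 (4); cell INBOX l.30215, l.30254 «LEMMA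
A∪2I′ §17′ (statement + the census as a finite structure)», l.30373 «4th = A∪2I′ §17′»). Fourth `Pad4Tower*` file; it
IMPORTS `Pad4TowerLemmaT` (cells, configurations, legs, RULE D, `StaticDeadW0∕W1`) and types PAD4-BALANCED-search-1.md v1.6
e2d93ac598b3704c §17 — the census (C1)–(C3) ∕ species (3a)–(3d) with its completeness proof (pencil, ×2 s4-ref-2 g8
743ff03f31655d32 ∕ e036450b1c974e99), the statement of record **LEMMA A∪2I′: «Z violates (E1) if
D(Z) ⊄ Σ_{w ∈ Dir_σ(Z)} Ξ_w ⊗ A_w + V_σ ⊗ Σ_{w′ ∈ W} Ξ_{w′}»** and its **CLEAN SUFFICIENT FORM «if no census member of species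
(3b), (3c), (3d) EXISTS in E₊ for any server of any u-partner, the states are computed from the u-partners alone, and the
conclusion holds as stated»** — in the (F1ℝ) non-negative single-apex world of §18 and of FILE `Pad4TowerLemmaT`.

THE ONE OBSERVATION THAT MAKES §17′ FINITE HERE. In the light-cone frame `(ξ̄₊, ξ̄₋)` of (F1ℝ) every subspace the lemma
mentions is a COORDINATE subspace of `V_σ ⊗ V_{f″}`: the lines `Ξ_±`, the states `A(d) ∈ {0, Ξ₊, Ξ₋, V_{f″}}`
(intersections of `Ξ`-lines), their sums, `V_σ ⊗ Ξ_{w′}`, and — by the PAIR-IMAGE THEOREM of §1′ (the `(r,r′)`-entry of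
`(Im Z)_{σ f″}` is `D_{r r′} = c_r(x_σ) − c_{r′}(x_{f″})` times a non-zero constant, the two `T_W`-coefficients independent)
— the demand `D(Z) = span{ξ̄_r ⊗ ξ̄_{r′} : Z σ r ≠ Z f″ r′}`. So «`D(Z) ⊄ fed subspace`» reads ENTRY BY ENTRY, and the
bottom-up recursion for the states has a closed SUFFICIENT form: `A(d) ∌ ξ̄_{r′}` for every present partner IF every present
partner has an UNPOLLUTED server in the other direction `v ≠ r′` (an unpolluted `v`-server confines into `Ξ_v ∌ ξ̄_{r′}`; a
confined deeper partner does not pollute) — sufficiency only: the converse would need the census-completeness material this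
file does not type (s4-ref g72 46423ed07fbc81e8 P1). Polluter liveness is taken PERMISSIVELY (present ⇒ pollutes): the clean form.

CONTENT (§6, continuing `Pad4TowerLemmaT` §1–§5).
* `Cell.le` (coordinatewise = letterwise-effective in light-cone coordinates), `LegBelow`, `R2aBelow`, `ServedDir` = the
  served set **`W_{f″}(Z)`** of (S3) (legs AND null `f″`-parts of (r2a) partners), `Demanded` = **`D(Z)`** entry-wise,
  `Polluter` = a census member of species **(3b) ∕ cross-pencil (3c) ∕ (3d)** of a server `N′ = P + e·e_{(f″,v)}` of the
  partner `P = Z − d·e_{(σ,r)}` ((C1) agrees with `Z` off `{(σ,r)} ∪ f″`; (C2) depth `≥ d`; (C3) `e·n_v − z` causal with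
  `z ≠ 0` off the `−v`… in components: `0 < z_v ≤ e ∧ z_v̄ ≤ 0`, or `z_v = 0 ∧ z_v̄ < 0`; (3a) = deeper partners enter through
  the closed form; in-pencil (3c) members do NOT pollute — the bidegree remark of §17), `CleanServer`, and the kill predicate
  **`A2IDead C Z σ f″`**: some entry `(r, r′)` is demanded, `r′ ∉ W_{f″}(Z)`, and every present `r`-partner of `Z` on `σ`
  has a clean server on `f″` in the direction `v ≠ r′`.
* PROVED: `A2IDead_of_staticDeadW0`, `A2IDead_of_staticDeadW1` — the two own-ray forms of `Pad4TowerLemmaT` §3 (the static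
  game's `JOB_LEMMAT=2∕3` kills with the all-depth proviso) ARE INSTANCES (entries `(s′, ±)` over an O-factor, resp.
  `(s′, v̄)` over a pure `v`-ray; their «no lifted class» provisos are exactly «no polluter» there).
* PROVED: `A2IDead_of_oneSided` and **`lemmaT_A2IDead`** — LEMMA T (vi) P-max form (FILE `Pad4TowerLemmaT`) run through the
  clean form: the server dies (`A2IDead`) as soon as for SOME side `w` of the O-factor no side-`w` lifted class is a `P`-cell —
  RULE D forces both directions of service, and ONE clean direction confines; so the (r4) «cousin-protected» residual of §18
  (vi) needs cousins on BOTH sides (a sharpening by composition of two ×2 statements; the composition is this file's, flagged).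
* §7 **LEMMA X-PHASE** (PAD4-BALANCED §22; of record since v2.3 acd94669f555557a = v2.5 22062135151090e5 with s4-ref g72's
  ×2 9150caba90bff308 folded — CONE hypothesis (H-e′) on σ, STRONG (H-b) on f; in (F1ℝ) = LEMMA X of §20.2) as the kill predicate
  `XPhaseDead`: `NothingBelowOffPair` ((H-b) strong, `n`-free, implies the printed reading for every sibling — s4-ref-2 g11's
  E-754-1 on v4), `NothingBelowOn` ((H-b) weak; implied), `NothingBelowPartner` ((H-a) of v2.2, the typed σ-hypothesis — suffices
  in (F1ℝ), ×2 s4-ref-2 g11 29b764b084d7482d + s4-ref g72 04030229eb8fbfb8), `ConePartner` ((H-e′) verbatim; implies (H-a)),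
  `XPhasePinned` ((H-a)+(H-c)+(H-d)); probes: the §22 example `[O|O|ℓ₋|6ℓ₋]` and g11's E-754-1 configuration (rejected). (The
  director's reserved «Pad4TowerCrossPhase», folded in here; the μ₄ directions `±iu` are outside the (F1ℝ) alphabet.)
* Kernel probes (`decide`): `A2IDead` on the T376 top pattern; and a four-cell pattern on which the machine's `W = ∅` rule
  (`StaticDeadW0`: O-factor served above in BOTH directions) FAILS while `A2IDead` HOLDS — one unpolluted server confines the
  partner to a line, and a line does not span `V_{f″}` (LEMMA 2I §15: «the whole V_{f′} must be spanned»): the clean form of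
  §17′ is strictly stronger than the v5–v7 static rule.

WHAT IS NOT HERE ∕ NOT IN LEAN. The (E1)-SOUNDNESS of `A2IDead` — LEMMA A∪2I′ itself (PROOF (1) DEMAND, (2) PINS, (3)),
the census COMPLETENESS proof (Künneth multidegree), the polluting∕non-polluting maps (P-ii)∕(P-iii) — all pencil ×2 and
all statements about the 𝔅 first-order cohomology model that the tree does not have (FILE A is class-y-only; see
`Pad4TowerLemmaT`'s docstring): «dead» here means «satisfies the predicate». Not typed either: liveness of polluters (the
non-clean form with ALIVE pieces = leak9), `|Dir_σ| > 1` bookkeeping beyond what the entry-wise form already covers, μ₄ ∕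
Pythagorean frames, the `P`-side duals. Nothing is a statement about a variety, a sheaf, `σ`, a seed or an abelian variety;
NOTHING HERE SAYS THAT HC ∕ HC_CM ∕ HC_AV ∕ W₆ ∕ HC_Kum4Type HOLDS OR FAILS. No `instance`, no notation, no named fact, 0 `sorry`; axioms standard.

SOURCES (sha16): PAD4-BALANCED-search-1.md v2.3 acd94669f555557a ∕ v2.5 22062135151090e5 §22 (LEMMA X-PHASE of record: (H-e′), strong
(H-b)), v2.2 2899cc7c41510061 §22 ((H-a)), §20.2 (LEMMA X); verdicts s4-ref g72 9150caba90bff308 (§22 (i)–(ii) ×2: O1 scope, (H-e′),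
strong (H-b)) and 04030229eb8fbfb8 (this file v4∕v5), s4-ref-2 g11 29b764b084d7482d (this file v4: E-754-1 weak (H-b), (H-a) suffices
in (F1ℝ)); v1.6 e2d93ac598b3704c §1′ (PAIR-IMAGE, (S3) coupling «Ξ_{(f,w)} = ℂξ̄_w,
V_f∕Ξ_{(f,w)} ≅ ℂ[ξ̄_{−w}]»), §15 (LEMMA 2I), §17 (SETTING, census, LEMMA A∪2I′ of record, O1∕O3, CLEAN SUFFICIENT FORM,
INSTANCES, PROOF (1)–(3), REMARKS); verdicts s4-ref-2 g8 743ff03f31655d32 ∕ e036450b1c974e99 (§17 ×2), s4-ref g70 + s4-ref-2 g9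
7a771f6b8d863ced (E-§18-1 ∕ O1 all-depth), s4-ref-2 g10 8a46b79f5650447c (v1 of `Pad4TowerLemmaT`); s4-search-1 g21 l.30221
(static8 v8: complete census, exact two-sided W = ∅ escape); `Pad4TowerLemmaT.lean` (this typer).
-/

namespace Summit.Ventures.HSemireg.Pad4Tower

open Finset

/-! ## §6 LEMMA A∪2I′ (§17′), CLEAN SUFFICIENT FORM, as a finite structure on (F1ℝ)≥0 configurations

PAD4-BALANCED v1.6 §17 (statement of record after s4-ref-2 g8's ×2: census (3a)–(3d) + completeness PASS ×2; LEMMA A∪2I′: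
«Z violates (E1) if D(Z) ⊄ Σ_{w ∈ Dir_σ(Z)} Ξ_w ⊗ A_w + V_σ ⊗ Σ_{w′ ∈ W} Ξ_{w′}»; CLEAN SUFFICIENT FORM: «if no census member of
species (3b), (3c), (3d) EXISTS in E₊ for any server of any u-partner, the states are computed from the u-partners alone»).
Here: the PAIR `(σ, f″)` of factors of an `N`-cell `Z` (`σ` carries the partners, `f″` the states), everything in the light-cone
frame of (F1ℝ), where every subspace in play (`Ξ₊`, `Ξ₋`, the states `A(d) ∈ {0, Ξ₊, Ξ₋, V}`, `D(Z)`) is a COORDINATE subspace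
in the basis `ξ̄_r^{(σ)} ⊗ ξ̄_{r′}^{(f″)}` — so containment is read ENTRY BY ENTRY, and the bottom-up state recursion of §17 has
the closed SUFFICIENT form used below (a state omits `ξ̄_{r′}` if every present partner at that depth or deeper has an
unpolluted server in direction `r̄′` — «if», not «iff»: s4-ref g72 P1; the converse is census completeness, not typed). Liveness of
polluters is taken PERMISSIVELY (a (3b)∕(3c-cross)∕(3d) member present in `E₊` pollutes) — the clean sufficient form. The
(E1)-meaning is, as for §3, the cell's pencil lemma and NOT a Lean statement. -/

/-- coordinatewise order on cells = «`P ≤ Z` letterwise» in (F1ℝ): a light-cone difference is effective (future-causal or 0)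
iff both coordinates are `≥ 0` on every factor. -/
abbrev Cell.le (P Z : Cell) : Prop := ∀ g r, P g r ≤ Z g r

/-- `P` is an (r1) LEG of `Z` below along `(f,w)`: equal off `(f,w)`, strictly smaller there. -/
abbrev LegBelow (Z P : Cell) (f : Fin 4) (w : Fin 2) : Prop := Agree1 P Z f w ∧ P f w < Z f w

/-- `P` is an (r2a) partner of `Z` below whose `f`-part is null in direction `w`: strictly smaller at `(f,w)` and at exactly one
coordinate of ONE other factor, equal elsewhere. -/
abbrev R2aBelow (Z P : Cell) (f : Fin 4) (w : Fin 2) : Prop :=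
  ∃ g : Fin 4, g ≠ f ∧ ∃ r : Fin 2, Agree2 P Z f w g r ∧ P f w < Z f w ∧ P g r < Z g r

/-- **`W_f(Z) ∋ w`**: the direction `w` on factor `f` is SERVED BELOW at `Z` in the sense of (S3) — by a leg or by the null
`f`-part of an (r2a) partner (§17 SETTING: «legs of Z on f′ AND (r2a)-type partners with a null f′-part»). -/
abbrev ServedDir (C : Config) (Z : Cell) (f : Fin 4) (w : Fin 2) : Prop := ∃ P ∈ C.upper, LegBelow Z P f w ∨ R2aBelow Z P f w

/-- **the demanded entries `D(Z)`** on the pair `(σ, f″)` (PAIR-IMAGE THEOREM §1′: the `(r, r′)`-entry of `(Im Z)_{σ f″}` is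
`D_{r r′} = c_r(x_σ) − c_{r′}(x_{f″})` up to non-zero constants, with the two `T_W`-coefficients independent): entry `(r,r′)` is
demanded iff the two light-cone coordinates DIFFER (this carries O3: `c_u(x_σ) = c(x_{f″})` kills the entry). -/
abbrev Demanded (Z : Cell) (σ : Fin 4) (r : Fin 2) (f'' : Fin 4) (r' : Fin 2) : Prop := Z σ r ≠ Z f'' r'

/-- **a POLLUTING census member** (species (3b), cross-pencil (3c), (3d) of §17; (3a) = deeper partners are handled by the
state recursion, in-pencil (3c) members do not pollute) of the server `N′ = P + e·e_{(f″,v)}` of the partner `P = Z − d·e_{(σ,r)}`: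
a `P′ ∈ E₊` agreeing with `Z` off `{(σ,r)} ∪ f″` ((C1)), on `Z`'s `(σ,r)`-line at depth `≥ d` ((C2)), and with `f″`-offset
`z = P′_{f″} − Z_{f″}` satisfying `e·n_v − z` causal, `z ≠ 0`, `z` not on the `−v` ray ((C3)): in light-cone components
`(z_v, z_v̄)` this is `(0 < z_v ≤ e ∧ z_v̄ ≤ 0)` [(3b) `z_v̄ = 0`, (3d) `z_v̄ < 0`] or `(z_v = 0 ∧ z_v̄ < 0)` [(3c), `w = v̄ ≠ v`]. -/
abbrev Polluter (Z P : Cell) (σ : Fin 4) (r : Fin 2) (f'' : Fin 4) (v : Fin 2) (e : ℕ) (P' : Cell) : Prop :=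
  (∀ g q, g ≠ f'' → ¬ (g = σ ∧ q = r) → P' g q = Z g q) ∧ P' σ r ≤ P σ r ∧
    ((Z f'' v < P' f'' v ∧ P' f'' v ≤ Z f'' v + e ∧ P' f'' v.rev ≤ Z f'' v.rev) ∨
      (P' f'' v = Z f'' v ∧ P' f'' v.rev < Z f'' v.rev))

/-- `N′ ∈ E₋` is an UNPOLLUTED SERVER of the partner `P` in direction `v` on `f″` (clean form: no polluting census member in `E₊`;
confinement of deeper partners is accounted for by the closed form in `A2IDead`). -/
abbrev CleanServer (C : Config) (Z P : Cell) (σ : Fin 4) (r : Fin 2) (f'' : Fin 4) (v : Fin 2) (N' : Cell) : Prop :=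
  Agree1 N' P f'' v ∧ P f'' v < N' f'' v ∧ ∀ P' ∈ C.upper, ¬ Polluter Z P σ r f'' v (N' f'' v - P f'' v) P'

/-- **LEMMA A∪2I′ KILL, CLEAN SUFFICIENT FORM, on the pair `(σ, f″)`** (§17′; finite and support-checkable): some entry `(r,r′)`
is DEMANDED, its `f″`-direction `r′` is NOT served below at `Z` (`r′ ∉ W_{f″}(Z)`), and it is NOT fed by the `r`-partners on `σ`:
EVERY present partner `Z − d·e_{(σ,r)}` has a clean server in the other direction `v ≠ r′` of `f″` (so, bottom-up, no state
`A_r(d)` contains `ξ̄_{r′}`; with NO present `r`-partner the clause holds vacuously — the entry is then unfed as soon as it is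
demanded and unserved, which inside a RULE-D-closed configuration only happens through (r2a) covers).
Pencil meaning (NOT in Lean): such a `Z` violates (E1) [§17 LEMMA A∪2I′ + CLEAN SUFFICIENT FORM, ×2 s4-ref-2 g8]. -/
abbrev A2IDead (C : Config) (Z : Cell) (σ f'' : Fin 4) : Prop :=
  σ ≠ f'' ∧ ∃ r r' v : Fin 2, v ≠ r' ∧ Demanded Z σ r f'' r' ∧ ¬ ServedDir C Z f'' r' ∧
    ∀ P ∈ C.upper, LegBelow Z P σ r → ∃ N' ∈ C.lower, CleanServer C Z P σ r f'' v N'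

/-! ### The two own-ray forms of §3 are instances -/

/-- a zero coordinate is never served below in direction `w` (legs and (r2a) parts would be negative). -/
theorem not_servedDir_of_zero (C : Config) {Z : Cell} {f : Fin 4} {w : Fin 2} (h0 : Z f w = 0) : ¬ ServedDir C Z f w := by
  rintro ⟨P, -, ⟨-, hlt⟩ | ⟨g, -, r, -, hlt, -⟩⟩ <;> omega

/-- in `Fin 2` the other side of `v` is `v.rev`. -/
theorem Fin2.eq_rev_of_ne : ∀ q v : Fin 2, q ≠ v → q = v.rev := by decide

/-- **`StaticDeadW0 ⇒ A2IDead`**: the `W = ∅` own-ray form is the instance «entry `(s′, a)` demanded (`Z σ s′ ≠ 0 = Z f″ a`),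
`a ∉ W` (O-factor), every present partner has a `b`-server, and a polluter of a `b`-server over an O-factor is a lifted class». -/
theorem A2IDead_of_staticDeadW0 (C : Config) {Z : Cell} {f' : Fin 4} {s' : Fin 2} {f'' : Fin 4}
    (h : StaticDeadW0 C Z f' s' f'') : A2IDead C Z f' f'' := by
  obtain ⟨hne, hO, hray, hconf, hlift⟩ := h
  refine ⟨hne, s', 0, 1, by decide, ?_, not_servedDir_of_zero C hO.1, ?_⟩
  · show Z f' s' ≠ Z f'' 0
    rw [hO.1]; exact hray.1
  · intro P hP hleg
    obtain ⟨N', hN', hagree, hlt⟩ := (hconf P hP hleg.1 hleg.2).2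
    refine ⟨N', hN', hagree, hlt, fun P' hP' hpol => hlift P' hP' ?_⟩
    obtain ⟨hag, hdepth, hz⟩ := hpol
    have hPσ : P f' s' < Z f' s' := hleg.2
    have h10 : (1 : Fin 2).rev = 0 := by decide
    rw [h10, hO.1, hO.2] at hz
    refine ⟨hag, by omega, Or.inr ⟨?_, ?_⟩⟩
    · show P' f'' 1 ≠ 0
      omega
    · show P' f'' (1 : Fin 2).rev = 0
      rw [h10]; omega

/-- **`StaticDeadW1 ⇒ A2IDead`**: the `|W| = 1` own-ray form is the instance «entry `(s′, v̄)` demanded (`Z σ s′ ≠ 0 = Z f″ v̄`),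
`v̄ ∉ W`, every present partner has a `v`-server, and a polluter of a `v`-server over a pure `v`-ray is a lifted class along `v`». -/
theorem A2IDead_of_staticDeadW1 (C : Config) {Z : Cell} {f' : Fin 4} {s' : Fin 2} {f'' : Fin 4} {v : Fin 2}
    (h : StaticDeadW1 C Z f' s' f'' v) : A2IDead C Z f' f'' := by
  obtain ⟨hne, hray, hray'', hconf, hlift⟩ := h
  have hvne : v ≠ v.rev := by fin_cases v <;> decide
  refine ⟨hne, s', v.rev, v, hvne, ?_, not_servedDir_of_zero C hray''.2, ?_⟩
  · show Z f' s' ≠ Z f'' v.rev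
    rw [hray''.2]; exact hray.1
  · intro P hP hleg
    obtain ⟨N', hN', hagree, hlt⟩ := hconf P hP hleg.1 hleg.2
    refine ⟨N', hN', hagree, hlt, fun P' hP' hpol => hlift P' hP' ?_⟩
    obtain ⟨hag, hdepth, hz⟩ := hpol
    have hPσ : P f' s' < Z f' s' := hleg.2
    have hz0 : Z f'' v.rev = 0 := hray''.2
    rw [hz0] at hz
    have hP'rev : P' f'' v.rev = 0 := by omega
    have hP'v : Z f'' v < P' f'' v := by omega
    refine ⟨?_, by omega, hP'v⟩
    intro g q hg1 hg2
    by_cases hgf : g = f''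
    · subst hgf
      have hq : q = v.rev := Fin2.eq_rev_of_ne q v (fun hqv => hg2 ⟨rfl, hqv⟩)
      subst hq
      rw [hz0, hP'rev]
    · exact hag g q hgf hg1

/-! ### Kernel probes -/

set_option synthInstance.maxSize 4096 in -- the unfolded predicate is one large decidable instance
/-- the T376 top pattern of `Pad4TowerLemmaT` §5: `A2IDead` holds at `N(1,0|0⁴|1,3)` for the pair `(σ, f″) = (0, 1)` (also a
consequence of `A2IDead_of_staticDeadW0` and `t376Top_staticDead`). [kernel, `decide`] -/
theorem t376Top_A2IDead : A2IDead t376Top (cellOf 1 0 0 0 0 0 1 3) 0 1 := by decide +kernel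

/-- the four-cell pattern of `j271928Top_alive_if_unserved`: `Z = (0,0|1,0|0,2|3,0)`, its partner `P₀ = (0,0|0,0|0,2|3,0)` and ONE
server `N = P₀ + e_{(0,a)}` of `P₀`'s O-factor `0` (the `(0,b)`-server absent). -/
def oneServer : Config where
  lower := {cellOf 0 0 1 0 0 2 3 0, cellOf 1 0 0 0 0 2 3 0}
  upper := {cellOf 0 0 0 0 0 2 3 0}

set_option synthInstance.maxSize 4096 in -- as above
/-- **the clean form is strictly stronger than the machine's `W = ∅` rule**: on `oneServer` the static predicate
`StaticDeadW0` FAILS (the O-factor is served above in one direction only — the v5–v7 escape «unconfined-capable»), while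
`A2IDead` HOLDS via the entry `(a, b)` of the pair `(σ, f″) = (1, 0)`: the single unpolluted `a`-server confines the partner's
state into `Ξ₊ ∌ ξ̄₋`, so the demanded `ξ̄₊^{(σ)} ⊗ ξ̄₋^{(f″)}` is unfed (LEMMA 2I: the whole `V_{f″}` must be spanned).
[kernel, `decide`] -/
theorem oneServer_A2IDead_not_static :
    ¬ StaticDeadW0 oneServer (cellOf 0 0 1 0 0 2 3 0) 1 0 0 ∧ A2IDead oneServer (cellOf 0 0 1 0 0 2 3 0) 1 0 := by
  decide +kernel

/-! ### LEMMA T through the clean form: one-sided cousin protection does not save the server -/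

/-- a lifted class on `Z`'s `(f′,s′)`-line over the O-factor `f″` ON SIDE `w` only (species (3b) for the `w`-servers). -/
abbrev LiftedClassSide (Z P : Cell) (f' : Fin 4) (s' : Fin 2) (f'' : Fin 4) (w : Fin 2) : Prop :=
  (∀ g r, g ≠ f'' → ¬ (g = f' ∧ r = s') → P g r = Z g r) ∧ P f' s' < Z f' s' ∧ pureRay P f'' w

/-- **confinement in ONE direction suffices** (§17′ clean form vs. the `W = ∅` machine rule): if `Z` has the O-factor `f″`, a pure
ray on `(f′,s′)`, every present `(f′,s′)`-partner has `f″` served above in direction `w`, and no lifted class ON SIDE `w` is a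
`P`-cell, then `A2IDead` holds (entry `(s′, w̄)`: demanded, `w̄ ∉ W`, the `w`-servers are clean — a polluter of a `w`-server over
an O-factor is exactly a side-`w` lifted class). -/
theorem A2IDead_of_oneSided (C : Config) {Z : Cell} {f' : Fin 4} {s' : Fin 2} {f'' : Fin 4} (hne : f' ≠ f'')
    (hO : isO Z f'') (hray : pureRay Z f' s') (w : Fin 2)
    (hconf : ∀ P ∈ C.upper, Agree1 P Z f' s' → P f' s' < Z f' s' → ServedAbove C P f'' w)
    (hlift : ∀ P ∈ C.upper, ¬ LiftedClassSide Z P f' s' f'' w) : A2IDead C Z f' f'' := by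
  have hw0 : Z f'' w = 0 := by fin_cases w <;> simp [hO.1, hO.2]
  have hw1 : Z f'' w.rev = 0 := by fin_cases w <;> simp [hO.1, hO.2]
  have hvne : w ≠ w.rev := by fin_cases w <;> decide
  refine ⟨hne, s', w.rev, w, hvne, ?_, not_servedDir_of_zero C hw1, ?_⟩
  · show Z f' s' ≠ Z f'' w.rev
    rw [hw1]; exact hray.1
  · intro P hP hleg
    obtain ⟨N', hN', hagree, hlt⟩ := hconf P hP hleg.1 hleg.2
    refine ⟨N', hN', hagree, hlt, fun P' hP' hpol => hlift P' hP' ?_⟩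
    obtain ⟨hag, hdepth, hz⟩ := hpol
    have hPσ : P f' s' < Z f' s' := hleg.2
    rw [hw0, hw1] at hz
    refine ⟨hag, by omega, ?_, ?_⟩
    · show P' f'' w ≠ 0
      omega
    · show P' f'' w.rev = 0
      omega

section LemmaTviaA2I

variable {C : Config} (hC : RuleDClosed C) {f : Fin 4} {s : Fin 2} {M : ℕ} {f'' : Fin 4}
  (hmax : ∀ P ∈ C.upper, ∀ r₀ : Fin 2, P f'' r₀ = 0 → P f s ≤ M)
include hC hmax

/-- **LEMMA T, P-MAX FORM, through §17′ — the cousin proviso is needed on BOTH sides to save the server.** Under the hypotheses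
of `lemmaT_server_confined` (FILE `Pad4TowerLemmaT`), the server `Z = P₀ + e·e_{(f′,s′)}` satisfies `A2IDead` as soon as, for
SOME side `w` of the O-factor `f″`, no side-`w` lifted class on its line is a `P`-cell: RULE D forces every partner's O-factor to
be served above in both directions, and one clean direction confines. So «cousin-protected» ((r4) of §18 (vi)) must mean
lifted classes present on BOTH sides of `f″`. [consequence of §17′ clean form (×2) + §18 (vi) (×2); the sharpening itself is
this file's, flagged for the referee] -/
theorem lemmaT_A2IDead {P₀ : Cell} (hP₀ : P₀ ∈ C.upper) (hM : 0 < M) (hP₀M : P₀ f s = M)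
    (hf'' : f'' ≠ f) (hO : isO P₀ f'')
    {f' : Fin 4} (hf'f : f' ≠ f) (hf'f'' : f' ≠ f'') {s' : Fin 2} (h3 : P₀ f' s'.rev = 0 ∧ P₀ f' s' ≠ M)
    {g : Fin 4} {r : Fin 2} (hgf' : g ≠ f') (hgf'' : g ≠ f'') (hgs : ¬ (g = f ∧ r = s)) (h1' : P₀ g r ≠ 0) :
    ∃ Z ∈ C.lower, Agree1 Z P₀ f' s' ∧ P₀ f' s' < Z f' s' ∧
      ∀ w : Fin 2, (∀ P ∈ C.upper, ¬ LiftedClassSide Z P f' s' f'' w) → A2IDead C Z f' f'' := by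
  obtain ⟨Z, hZl, hZagree, hZlt, hZO, hZray, hconf⟩ :=
    lemmaT_server_confined hC hmax hP₀ hM hP₀M hf'' hO hf'f hf'f'' h3 hgf' hgf'' hgs h1'
  refine ⟨Z, hZl, hZagree, hZlt, fun w hlift => A2IDead_of_oneSided C hf'f'' hZO hZray w ?_ hlift⟩
  intro P hP hag hlt
  have hboth := hconf P hP hag hlt
  fin_cases w
  · exact hboth.1
  · exact hboth.2

end LemmaTviaA2I

/-! ## §7 LEMMA X-PHASE (§22; in (F1ℝ): LEMMA X of §20.2) — the cross-direction same-factor pin, as a finite structure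

PAD4-BALANCED §22 (s4-search-1 g21; stated v2.1∕v2.2 2026-08-27T09:59Z–10:03Z, pencil + read off leak9's fixpoint, kit j275278;
**×2 s4-ref g72 9150caba90bff308: (i) NO OBJECTION; (ii) NO OBJECTION on the cell's alphabets (U5∕U6 280∕280, ray∕tower letters
over O 768∕768) + SCOPE OBJECTION O1 on ℤ^{1,2}, met in the text OF RECORD v2.3 acd94669f555557a (= v2.5 22062135151090e5 here) by
(H-e′) and the STRONG (H-b); (iii) not ×2'd**). Abridged: «Let Z ∈ E₋ and σ a factor on which Z has a u-PARTNER
q = Z − d·n_u^{(σ)} ∈ E₊. Assume (H-e′) [replacing v2.2's (H-a), which it contains]: every P′ with P′_g = Z_g for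
all g ≠ σ has its σ-letter in the CLOSED FUTURE CONE of q_σ (automatic when q_σ is the cone vertex of the design's σ-letters, e.g.
the (F1ℝ) floor corner). Let f ≠ σ be a factor with (H-b), strong reading: no P′ ≤ n (n as in (H-c); n_f = Z_f) with P′_f ≠ Z_f
(then W_f(Z) = ∅ and Ξ_u^{(σ)} ⊗ V_f is demanded at Z, fed only by the nodes of Z's u-partners). LEMMA X-PHASE. Suppose (H-c): for
some null direction w ≠ u on σ and some e ≥ 1 the class n := q + e·n_w^{(σ)} is an N-constituent, and (H-d): no P-constituent of
class q + e′·n_w^{(σ)} with 1 ≤ e′ < e exists. Then q's node vanishes on every solution of the homogeneous rows of column Z; if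
every u-partner of Z on σ satisfies (H-e′)+(H-c)+(H-d), Z violates (E1).» In (F1ℝ) the only `w ≠ u` is `ū` (§22
REMARK (4): LEMMA X of §20.2 is the special case; in class y the lemma is void); the μ₄ directions `±iu` are outside this file's
alphabet. TYPING CHOICES (both refereed): on σ the file keeps v2.2's (H-a) in its parametric form (`NothingBelowPartner`), which
(H-e′) (`ConePartner`) implies (lemma `nothingBelowPartner_of_conePartner`) and which in (F1ℝ) already closes the σ-census of
PROOF (ii) — ×2: s4-ref-2 g11 29b764b084d7482d §2 (degree count) and s4-ref g72 04030229eb8fbfb8 §3(d) (a `P′ ≤ n` agreeing with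
`Z` off `σ` is on the segment `q…n`, timelike-past of `Z_σ`, or of the (H-a) form); on f the file types the strong (H-b) in an `n`-FREE
form (`NothingBelowOffPair`: every P-cell that is `≤ Z` off σ, whatever its σ-letter, agrees with `Z` on `f`), which implies the
printed `n`-reading for every sibling `n` (lemma `offPair_sibling`), s4-ref g72's reading «agreeing with Z off {σ,f}» and v2.2's
weak (H-b) (lemma `nothingBelowOn_of_offPair`). The (E1)-conclusion is, as everywhere in this file, NOT a Lean statement. -/

/-- **(H-b) NOTHING BELOW `Z` ON `f`, weak reading** (v2.2): no `P`-cell `≤ Z` differs from `Z` on `f` (so `W_f(Z) = ∅`). -/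
abbrev NothingBelowOn (C : Config) (Z : Cell) (f : Fin 4) : Prop :=
  ∀ P ∈ C.upper, P.le Z → P f 0 = Z f 0 ∧ P f 1 = Z f 1

/-- **(H-b), STRONG READING, `n`-free form** (text of record v2.3: «no P-constituent P′ ≤ n (n_f = Z_f) with P′_f ≠ Z_f»; s4-ref
g72 9150caba90bff308 §2 (B): «no P′ agreeing with Z off {σ, f} with (Z − P′)_f effective ≠ 0»; s4-ref-2 g11 E-754-1 on v4 of this
file): every `P`-cell that is `≤ Z` OFF `σ` — WHATEVER its `σ`-letter — agrees with `Z` on `f`. It implies the printed reading for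
every sibling `n` (`offPair_sibling`), g72's reading, and the weak (H-b) (`nothingBelowOn_of_offPair`); all coincide when `Z_f = O`. -/
abbrev NothingBelowOffPair (C : Config) (Z : Cell) (σ f : Fin 4) : Prop :=
  ∀ P ∈ C.upper, (∀ g r, g ≠ σ → P g r ≤ Z g r) → P f 0 = Z f 0 ∧ P f 1 = Z f 1

/-- strong (H-b) ⇒ weak (H-b). -/ theorem nothingBelowOn_of_offPair (C : Config) {Z : Cell} {σ f : Fin 4} (h : NothingBelowOffPair C Z σ f) :
    NothingBelowOn C Z f :=
  fun P hP hle => h P hP fun g r _ => hle g r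

/-- … and the printed v2.3 reading «no `P′ ≤ n` with `P′_f ≠ Z_f`» for EVERY cell `n` agreeing with `Z` off `σ` (all siblings). -/
theorem offPair_sibling (C : Config) {Z : Cell} {σ f : Fin 4} (h : NothingBelowOffPair C Z σ f) {n : Cell}
    (hn : ∀ g r, g ≠ σ → n g r = Z g r) : ∀ P ∈ C.upper, P.le n → P f 0 = Z f 0 ∧ P f 1 = Z f 1 :=
  fun P hP hle => h P hP fun g r hg => hn g r hg ▸ hle g r

/-- (H-b) as printed empties `W_f(Z)`: no direction on `f` is served below at `Z`. -/
theorem not_servedDir_of_nothingBelowOn (C : Config) {Z : Cell} {f : Fin 4} (h : NothingBelowOn C Z f) (w : Fin 2) :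
    ¬ ServedDir C Z f w := by
  rintro ⟨P, hP, hs⟩
  have hlt : P f w < Z f w := by rcases hs with ⟨-, hlt⟩ | ⟨-, -, -, -, hlt, -⟩ <;> exact hlt
  have hle : P.le Z := fun g' r' => by
    rcases hs with ⟨hag, -⟩ | ⟨g, -, r, hag, -, hlt'⟩ <;> by_cases h' : g' = f ∧ r' = w
    · obtain ⟨rfl, rfl⟩ := h'; omega
    · rw [hag g' r' h']
    · obtain ⟨rfl, rfl⟩ := h'; omega
    · by_cases h'' : g' = g ∧ r' = r
      · obtain ⟨rfl, rfl⟩ := h''; omega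
      · rw [hag g' r' h' h'']
  have := h P hP hle
  fin_cases w <;> simp_all

/-- **(H-a) NOTHING BELOW the partner `q` ON `σ`** (v2.2): no `P`-cell agreeing with `q` off the factor `σ` lies strictly below `q`
along `u` while not below it along `ū` (`q_σ − c·e_u + a·e_ū`, `c ≥ 1`, `a ≥ 0`); automatic when `q σ u = 0` (floor point). -/
abbrev NothingBelowPartner (C : Config) (q : Cell) (σ : Fin 4) (u : Fin 2) : Prop :=
  ∀ P ∈ C.upper, (∀ g r, g ≠ σ → P g r = q g r) → P σ u < q σ u → P σ u.rev < q σ u.rev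

/-- **(H-e′), the CONE hypothesis of the text of record** (v2.3, s4-ref g72): every `P`-cell agreeing with `q` off `σ` has its
`σ`-letter in the closed future cone of `q_σ` (both light-cone coordinates `≥`); automatic at the floor corner; implies (H-a). -/
abbrev ConePartner (C : Config) (q : Cell) (σ : Fin 4) : Prop :=
  ∀ P ∈ C.upper, (∀ g r, g ≠ σ → P g r = q g r) → q σ 0 ≤ P σ 0 ∧ q σ 1 ≤ P σ 1

/-- (H-e′) ⇒ (H-a). -/
theorem nothingBelowPartner_of_conePartner (C : Config) {q : Cell} {σ : Fin 4} (h : ConePartner C q σ) (u : Fin 2) :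
    NothingBelowPartner C q σ u := fun P hP hag hlt => by
  have hle : ∀ v : Fin 2, q σ v ≤ P σ v := fun v => by fin_cases v <;> [exact (h P hP hag).1; exact (h P hP hag).2]
  exact absurd hlt (not_lt.mpr (hle u))

/-- **the X-PHASE PIN of a `u`-partner `q` of `Z` on `σ`** ((H-a) [for the text's (H-e′) = `ConePartner`, which implies it] +
(H-c) + (H-d) in (F1ℝ)): nothing below `q` on `σ`; some `N`-cell `n = q + e·e_{(σ,ū)}`, `e ≥ 1`, is present (a `σ`-server of the
PARTNER in the OTHER direction — a phase sibling of `Z` when `e = d`); no `ū`-companion `q + e′·e_{(σ,ū)}`, `1 ≤ e′ < e`, is a `P`-cell. -/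
abbrev XPhasePinned (C : Config) (q : Cell) (σ : Fin 4) (u : Fin 2) : Prop :=
  NothingBelowPartner C q σ u ∧
  ∃ n ∈ C.lower, Agree1 n q σ u.rev ∧ q σ u.rev < n σ u.rev ∧
    ∀ P ∈ C.upper, Agree1 P q σ u.rev → q σ u.rev < P σ u.rev → ¬ P σ u.rev < n σ u.rev

/-- **LEMMA X-PHASE KILL ((F1ℝ) = LEMMA X), as a predicate** (text of record v2.3 §22 with (H-a) for (H-e′) on σ — sufficient in
(F1ℝ), ×2 s4-ref-2 g11 + s4-ref g72 — and the strong (H-b), `n`-free): `σ ≠ f`; some entry of `Ξ_u^{(σ)} ⊗ V_f` is demanded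
(`Z σ u ≠ Z f r′` — PAIR-IMAGE); (H-b) weak (implied; kept for reading) AND strong; EVERY present `u`-partner of `Z` on `σ` is
X-phase pinned (none present ⇒ unfed outright). Pencil meaning (NOT in Lean): `Z` violates (E1). -/
abbrev XPhaseDead (C : Config) (Z : Cell) (σ : Fin 4) (u : Fin 2) (f : Fin 4) : Prop :=
  σ ≠ f ∧ (∃ r' : Fin 2, Demanded Z σ u f r') ∧ NothingBelowOn C Z f ∧ NothingBelowOffPair C Z σ f ∧
    ∀ q ∈ C.upper, LegBelow Z q σ u → XPhasePinned C q σ u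

/-- the instrumented example of §22 in (F1ℝ): `Z = [O|O|ℓ₋|6ℓ₋] = (0,0|0,0|0,1|0,6)`, its unique `b`-partner on factor `2`
`q = (0,0|0,0|0,0|0,6)`, and the phase sibling `n = q + e_{(2,a)} = [O|O|ℓ₊|6ℓ₋]`; apex factor `f = 0`. -/
def xPhaseExample : Config where
  lower := {cellOf 0 0 0 0 0 1 0 6, cellOf 0 0 0 0 1 0 0 6}
  upper := {cellOf 0 0 0 0 0 0 0 6}

set_option synthInstance.maxSize 4096 in -- as above
/-- `Z = [O|O|ℓ₋|6ℓ₋]` is X-phase dead in the three-cell pattern (`σ = 2`, `u = b`, `f = 0`): its partner's node is pinned by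
the row of the sibling `[O|O|ℓ₊|6ℓ₋]` (§22 REMARK (2), the j275278 read-off), and removing the sibling un-kills it.
[kernel, `decide`] -/
theorem xPhaseExample_dead :
    XPhaseDead xPhaseExample (cellOf 0 0 0 0 0 1 0 6) 2 1 0 ∧
    ¬ XPhaseDead ⟨{cellOf 0 0 0 0 0 1 0 6}, {cellOf 0 0 0 0 0 0 0 6}⟩ (cellOf 0 0 0 0 0 1 0 6) 2 1 0 := by
  decide +kernel

/-- s4-ref-2 g11's E-754-1 configuration (verdict 29b764b084d7482d §3): `Z = (1,0|0,0|0,1|0,6)`, sibling `n = (1,0|0,0|1,0|0,6)`,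
partner `q = (1,0|0,0|0,0|0,6)`, and `P′ = (0,0|0,0|1,0|0,6)` (`≤ n`, not `≤ Z`, `P′_0 ≠ Z_0`); `σ = 2`, `u = b`, `f = 0`. -/
def e7541Witness : Config where
  lower := {cellOf 1 0 0 0 0 1 0 6, cellOf 1 0 0 0 1 0 0 6}
  upper := {cellOf 1 0 0 0 0 0 0 6, cellOf 0 0 0 0 1 0 0 6}

set_option synthInstance.maxSize 4096 in -- as above
/-- on g11's configuration the weak (H-b) holds and the partner is pinned, but `Z` is NOT X-phase dead (the strong (H-b) rejects
`P′`; v4 called it dead — E-754-1; pencil: `P′` reaches the pin row, «polluter situation, no pin»). [kernel, `decide`] -/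
theorem e7541Witness_not_dead :
    NothingBelowOn e7541Witness (cellOf 1 0 0 0 0 1 0 6) 0 ∧
    (∀ q ∈ e7541Witness.upper, LegBelow (cellOf 1 0 0 0 0 1 0 6) q 2 1 → XPhasePinned e7541Witness q 2 1) ∧
    ¬ XPhaseDead e7541Witness (cellOf 1 0 0 0 0 1 0 6) 2 1 0 := by
  decide +kernel

end Summit.Ventures.HSemireg.Pad4Tower
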